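import Summits.KontsevichZagierPeriods.KontsevichZagierPeriods.Theorems.LinRedNormalFormHoffmanSpanInKZSpanTransfer
import Summits.KontsevichZagierPeriods.KontsevichZagierPeriods.Theorems.FurushoPentagonKernelModuloPeriodConjectureLeafWeightLeSeventeen
import Summits.KontsevichZagierPeriods.KontsevichZagierPeriods.Theorems.FurushoPentagonKernelModuloPeriodConjectureMzvSectorLeafOn
import Summits.KontsevichZagierPeriods.KontsevichZagierPeriods.Theorems.FurushoPentagonIntegerDivision

/-!
# Crux `LinRedNormalForm.HoffmanSpanInKZ` (stmt-KontsevichZagierPeriods-15044) — line `assoc-reduced`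

Strategist's ALTERNATIVE line (transfer lens: the solved sibling step is `FurushoPentagon.PentagonInKZ`,
PROVED in the tree — `Summit.KontsevichZagierPeriods.FurushoPentagon.PentagonInKZ.PentagonInKZ_of`).

The rules associator `Φ_P ∈ P_ℚ⟨⟨X₀,X₁⟩⟩` is a group-like solution of Drinfeld's pentagon (tree
theorems).  Hence EVERY coefficient identity valid at all group-like pentagon solutions over REDUCED
commutative `ℚ`-algebras holds for the MZV classes in `P_ℚ` — provided `P_ℚ` is reduced, i.e.
`FurushoPentagon.ReducedPeriodRing` (open item stmt-KontsevichZagierPeriods-3929, staffed on that route;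
only the summit is known to imply it).  The per-weight input is the ASSOCIATOR Hoffman-spanning leaf
`LeafAt s` (verbatim FurushoPentagon's `AssociatorHoffmanSpanning`, LANDED for every weight `≤ 17`:
`stub_associatorHoffmanSpanning_of_weight_le_17`), whose all-weight form is the coordinate form of
`𝔤𝔯𝔱₁ = 𝔤ᵐ` (Drinfeld 1991 §6 / Ihara / Deligne; Brown 2012 gives `𝔤ᵐ ↪ 𝔤𝔯𝔱₁`, Furusho 2011 gives
`𝔤𝔯𝔱₁ ↪ 𝔡𝔪𝔯₀`): a conjecture IMPLIED BY, and a priori WEAKER THAN, the extended-double-shuffle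
completeness `𝔡𝔪𝔯₀ = 𝔤ᵐ` (IKZ 2006 Conj. 1) which is the tail `stub_edsTail` of the live line `Sketch`.
THIS IS THE TRADE: a weaker tail, at the price of `ReducedPeriodRing`.

The bridge `ReducedPeriodRing → PentagonInKZ → (∀ s, LeafAt s) → HoffmanSpanInKZ` is PROVED below
(`formalSpanW_of_leafAt`: read the leaf at `Φ_P` keeping the weight; `spanAt_of_formalSpanW`: clear
denominators, pull back along `P ↪ P_ℚ` by `IntegerDivision`, rescale by `scaleQ`, divide by
`IntegerDivision`, off-domain freedom, `Negative/Divergence` for non-admissible words).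

Stubs (3): `stub_reducedPeriodRing` (open, shared with FurushoPentagon), `stub_assocTail` (the leaf in
weights `≥ 18`, `𝔤𝔯𝔱₁ = 𝔤ᵐ`-grade, shared with FurushoPentagon's certificate programme — weight 18 in
flight there), and `stub_pentagonInKZ` — A TREE THEOREM (`PentagonInKZ_of`) that cannot be IMPORTED next
to the leaf files today: `Theorems/FurushoPentagonPentagonInKZ` (via Literature `DrinfeldAssociatorToolkit`)
and the leaf side (via Literature `AssociatorsDefectSeriesProofs`) both declare
`Literature.NumberTheory.Transcendental.NCSeries.push_ofFn` — "environment already contains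
'…NCSeries.push_ofFn.match_1_1'"; closing this stub = renaming that private helper in ONE Literature file
(operator hygiene), nothing mathematical.  Composition `HoffmanSpanInKZ_of_stubs` is sorry-free;
`HoffmanSpanInKZ_of` concludes the crux by name.

Sources: V. Drinfeld, Leningrad Math. J. 2 (1991) §5–6; H. Furusho, Ann. of Math. 171 (2010); 174 (2011)
Thm 1.2; F. Brown, Ann. of Math. 175 (2012) Thm 1.1; T. Willwacher, Invent. Math. 200 (2015) Thm 1.1
(`H⁰(GC₂) ≅ 𝔤𝔯𝔱₁`); K. Ihara, M. Kaneko, D. Zagier, Compos. Math. 142 (2006) Conj. 1; M. Kontsevich,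
D. Zagier, Periods (2001) §1.2, §4.1.
-/

noncomputable section

namespace Summit.KontsevichZagierPeriods.KontsevichZagierPeriods.Cruxes.HoffmanSpanInKZ.AssocReduced

open Literature.NumberTheory.Transcendental
open Literature.NumberTheory.Transcendental.KZ
open Summit.KontsevichZagierPeriods.MzvKernelInKZ.Negative
open Summit.KontsevichZagierPeriods.MzvKernelInKZ.TwoPosets
open Summit.KontsevichZagierPeriods.LinRedNormalForm.HoffmanSpanInKZ
  (hoffmanGens SpanAt hoffmanSpanInKZ_iff zWord_bword_mem_hoffmanGens)
open Summit.KontsevichZagierPeriods.KontsevichZagierPeriods.Theses.FurushoPentagon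
  (PentagonInKZ ReducedPeriodRing)
open Summit.KontsevichZagierPeriods.KontsevichZagierPeriods.Theses.LinRedNormalForm (HoffmanSpanInKZ)
open Summit.KontsevichZagierPeriods.FurushoPentagon.PentagonInKZNegative (pentagonInKZ_iff_rulesAssociator)
open Summit.KontsevichZagierPeriods.FurushoPentagon.DoubleShuffleOfPentagon (isReduced_formalPeriodAlgebra)
open Summit.KontsevichZagierPeriods.FurushoPentagon.KernelModuloPeriodConjecture
  (isGroupLike_rulesAssociator formalSpan_neg_one_pow_mul sectorKernel_toPeriodAlgebra_injective
    stub_associatorHoffmanSpanning_of_weight_le_17)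

/-- The associator Hoffman-spanning LEAF at one admissible index `s` (verbatim the body of
`FurushoPentagon.KernelModuloPeriodConjecture.stub_associatorHoffmanSpanning_of_weight_le_17`): one
finitely supported `b` on Hoffman indices of the weight of `s` with `c_{bw s}(φ) = Σ_t b_t c_{bw t}(φ)`
at every group-like solution `φ` of Drinfeld's pentagon over every reduced commutative `ℚ`-algebra. -/
def LeafAt (s : List ℕ) : Prop :=
  ∃ b : List ℕ →₀ ℚ, (∀ t ∈ b.support, MZV.IsHoffman t ∧ MZV.weight t = MZV.weight s) ∧
    ∀ (R : Type) [CommRing R] [Algebra ℚ R] [IsReduced R] (φ : NCSeries Bool R),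
      NCSeries.IsGroupLike φ → NCSeries.DrinfeldPentagon φ →
        φ (MZV.binaryWord s) = b.sum (fun t q => q • φ (MZV.binaryWord t))

/-! ## Registered stubs -/

/-- Stub 1 (open, SHARED with route FurushoPentagon, item stmt-KontsevichZagierPeriods-3929): the formal
period ring `P = KZ.FormalRep ⧸ KZ.relations` is reduced. -/
theorem stub_reducedPeriodRing : ReducedPeriodRing := by
  sorry

/-- Stub 2 (THE OPEN TAIL of this line): the associator Hoffman-spanning leaf in every weight `≥ 18`
(coordinate form of `𝔤𝔯𝔱₁ ≅ 𝔤ᵐ` weight by weight; decidable per weight by the `LinEDS` block certificates of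
route FurushoPentagon, whose weight-18 tables are in flight). -/
theorem stub_assocTail :
    ∀ s : List ℕ, MZV.IsAdmissible s → 18 ≤ MZV.weight s → LeafAt s := by
  sorry

/-- Stub 3 (A TREE THEOREM, `FurushoPentagon.PentagonInKZ.PentagonInKZ_of`; stubbed ONLY because its
module cannot be co-imported with the leaf files — duplicate declaration `NCSeries.push_ofFn` in the two
Literature closures; closing it = that rename): the rules associator satisfies Drinfeld's pentagon. -/
theorem stub_pentagonInKZ : PentagonInKZ := by
  sorry

/-! ## G1 with the weight kept -/

/-- Under `PentagonInKZ` and `ReducedPeriodRing`, the leaf at an admissible `s`, read at the rules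
associator `Φ_P` over the reduced `ℚ`-algebra `P_ℚ`, gives
`1 ⊗ ⟦ζ(s)⟧ ∈ span_ℚ {1 ⊗ ⟦ζ(t)⟧ : t Hoffman, |t| = |s|}`. [cite: Furusho2011, Thm 1.2] -/
theorem formalSpanW_of_leafAt (hP : PentagonInKZ) (hR : ReducedPeriodRing) {s : List ℕ}
    (hs : MZV.IsAdmissible s) (hA : LeafAt s) :
    toPeriodAlgebra (mzvClass s) ∈ Submodule.span ℚ (Set.range
      (fun t : {t : List ℕ // MZV.IsHoffman t ∧ MZV.weight t = MZV.weight s} =>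
        toPeriodAlgebra (mzvClass t.1))) := by
  haveI : IsReduced FormalPeriodAlgebra := isReduced_formalPeriodAlgebra hR
  have hPent : NCSeries.DrinfeldPentagon rulesAssociator := pentagonInKZ_iff_rulesAssociator.mp hP
  obtain ⟨b, hb, hall⟩ := hA
  have key := hall FormalPeriodAlgebra rulesAssociator isGroupLike_rulesAssociator hPent
  rw [rulesAssociator_binaryWord hs] at key
  have hx : toPeriodAlgebra (mzvClass s) =
      (-1 : FormalPeriodAlgebra) ^ MZV.depth s *
        b.sum (fun t q => q • rulesAssociator (MZV.binaryWord t)) := by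
    rw [← key, ← mul_assoc, ← pow_add, ← two_mul, pow_mul, neg_one_sq, one_pow, one_mul]
  rw [hx, formalSpan_neg_one_pow_mul]
  refine Submodule.smul_mem _ _ ?_
  rw [Finsupp.sum]
  refine Submodule.sum_mem _ fun t ht => ?_
  have hH : MZV.IsHoffman t := (hb t ht).1
  rw [rulesAssociator_binaryWord hH.isAdmissible, formalSpan_neg_one_pow_mul]
  refine Submodule.smul_mem _ _ (Submodule.smul_mem _ _ (Submodule.subset_span ?_))
  exact ⟨⟨t, hH, (hb t ht).2⟩, rfl⟩

/-! ## Descent from `P_ℚ` to the crux's `ℤ`-form -/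

/-- A finite family of rationals has a common denominator. [folklore] -/
theorem exists_common_den {ι : Type*} (S : Finset ι) (c : ι → ℚ) :
    ∃ D : ℕ, 0 < D ∧ ∀ i ∈ S, ∃ a : ℤ, (a : ℚ) = (D : ℚ) * c i := by
  classical
  refine ⟨∏ i ∈ S, (c i).den, Finset.prod_pos fun i _ => (c i).den_pos, fun i hi => ?_⟩
  obtain ⟨k, hk⟩ := Finset.dvd_prod_of_mem (fun i => (c i).den) hi
  refine ⟨(k : ℤ) * (c i).num, ?_⟩
  rw [hk]
  push_cast
  rw [mul_comm ((c i).den : ℚ) (k : ℚ), mul_assoc, Rat.den_mul_eq_num]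

/-- Natural multiples of a word class: `n • ⟦[Δ, c·ω_ε]⟧ = ⟦[Δ, (n c)·ω_ε]⟧` (integrand additivity). -/
theorem nsmul_mk_zWord {N : ℕ} (ε : Fin N → Bool) (c : ℚ) (n : ℕ) :
    n • (QuotientAddGroup.mk (zWord N ε c) : KZ.FormalRep ⧸ KZ.relations) =
      QuotientAddGroup.mk (zWord N ε (n * c)) := by
  induction n with
  | zero => rw [zero_nsmul, Nat.cast_zero, zero_mul, mk_zWord_zero]
  | succ n ih => rw [succ_nsmul, ih, Nat.cast_succ, add_mul, one_mul, mk_zWord_add]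

/-- Integer multiples of a word class. -/
theorem zsmul_mk_zWord {N : ℕ} (ε : Fin N → Bool) (c : ℚ) (n : ℤ) :
    n • (QuotientAddGroup.mk (zWord N ε c) : KZ.FormalRep ⧸ KZ.relations) =
      QuotientAddGroup.mk (zWord N ε (n * c)) := by
  obtain ⟨k, rfl | rfl⟩ := Int.eq_nat_or_neg n
  · rw [natCast_zsmul, nsmul_mk_zWord, Int.cast_natCast]
  · rw [neg_zsmul, natCast_zsmul, nsmul_mk_zWord, Int.cast_neg, Int.cast_natCast, neg_mul]
    have h := mk_zWord_add ε ((k : ℚ) * c) (-((k : ℚ) * c))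
    rw [add_neg_cancel, mk_zWord_zero] at h
    exact neg_eq_of_add_eq_zero_right h.symm

/-- An index of weight `N` with a given admissible word. -/
theorem exists_index' {N : ℕ} (ε : Fin N → Bool) (hε : Adm ε) :
    ∃ u : List ℕ, MZV.IsAdmissible u ∧ MZV.weight u = N ∧ bword N u = ε := by
  rcases Nat.eq_zero_or_pos N with rfl | hN
  · exact ⟨[], MZV.isAdmissible_nil, rfl, funext fun i => i.elim0⟩
  · obtain ⟨u, hu, huw, hb⟩ := exists_index_of_adm hN ε hε
    refine ⟨u, hu, huw, funext fun i => ?_⟩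
    simp [bword, wordOf, hb, List.getD_eq_getElem?_getD, i.isLt]

/-- **Descent.** Formal Hoffman spanning in `P_ℚ` (weight kept) gives the weight-`N` slice of the
crux: clear denominators, pull back along `P ↪ P_ℚ` (`IntegerDivision`), rescale by `q` (`scaleQ`),
divide by the common denominator (`IntegerDivision`), pass to an arbitrary generator by off-domain
freedom; a non-admissible word carries no representation (`Negative/Divergence`). -/
theorem spanAt_of_formalSpanW {N : ℕ}
    (h : ∀ s : List ℕ, MZV.IsAdmissible s → MZV.weight s = N →
      toPeriodAlgebra (mzvClass s) ∈ Submodule.span ℚ (Set.range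
        (fun t : {t : List ℕ // MZV.IsHoffman t ∧ MZV.weight t = MZV.weight s} =>
          toPeriodAlgebra (mzvClass t.1)))) :
    SpanAt N := by
  classical
  intro ε q s hd hi
  by_cases hε : Adm ε
  swap
  · exact ⟨0, zero_mem _, by simpa using of_mem_relations_of_not_adm s hd hi hε⟩
  obtain ⟨sidx, hadm, hsw, hbw⟩ := exists_index' ε hε
  subst hsw
  obtain ⟨c, hc⟩ := (Finsupp.mem_span_range_iff_exists_finsupp).1 (h sidx hadm rfl)
  obtain ⟨D, hD, hden⟩ := exists_common_den c.support (fun t => c t)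
  choose! a ha using hden
  have hD' : (D : ℚ) ≠ 0 := by exact_mod_cast hD.ne'
  -- the identity in `P`: `D • ⟦ζ(sidx)⟧ = Σ_t a_t • ⟦ζ(t)⟧`
  have hPid : (D : ℤ) • mzvClass sidx = ∑ t ∈ c.support, a t • mzvClass t.1 := by
    apply sectorKernel_toPeriodAlgebra_injective
    rw [map_zsmul, map_sum, ← hc, Finsupp.sum, Finset.smul_sum]
    refine Finset.sum_congr rfl fun t ht => ?_
    rw [map_zsmul, ← Int.cast_smul_eq_zsmul ℚ (D : ℤ), smul_smul, ← Int.cast_smul_eq_zsmul ℚ (a t),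
      ha t ht, Int.cast_natCast]
  -- the same identity as a relation in `KZ.FormalRep`
  have hcls : ∀ (u : List ℕ) (hu : MZV.IsAdmissible u), mzvClass u = toFormalPeriod (zIdx u 1) :=
    fun u hu => by rw [mzvClass_of_isAdmissible hu, zIdx_one_eq_of_mzvRep u hu]
  have hrel : (D : ℤ) • zIdx sidx 1 - ∑ t ∈ c.support, a t • zIdx t.1 1 ∈ KZ.relations := by
    rw [← toFormalPeriod_eq_zero_iff, map_sub, map_zsmul, map_sum, sub_eq_zero, ← hcls sidx hadm, hPid]
    exact Finset.sum_congr rfl fun t _ => by rw [map_zsmul, ← hcls t.1 t.2.1.isAdmissible]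
  -- pass to the quotient group and rescale by `q`
  have hQ : (D : ℤ) • (QuotientAddGroup.mk (zIdx sidx 1) : KZ.FormalRep ⧸ KZ.relations) =
      ∑ t ∈ c.support, a t • (QuotientAddGroup.mk (zIdx t.1 1) : KZ.FormalRep ⧸ KZ.relations) := by
    have := (QuotientAddGroup.eq_iff_sub_mem).mpr hrel
    simpa only [QuotientAddGroup.mk_zsmul, QuotientAddGroup.mk_sum] using this
  have hQq := congrArg (scaleQ q) hQ
  rw [map_zsmul, map_sum] at hQq
  simp only [map_zsmul, zIdx, scaleQ_mk_zWord, mul_one] at hQq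
  -- the Hoffman combination
  set m : KZ.FormalRep :=
    ∑ t ∈ c.support, zWord (MZV.weight sidx) (bword (MZV.weight sidx) t.1) ((a t : ℚ) * q / D) with hm
  have hmQ : (D : ℤ) • (QuotientAddGroup.mk m : KZ.FormalRep ⧸ KZ.relations) =
      ∑ t ∈ c.support, a t • (QuotientAddGroup.mk
        (zWord (MZV.weight t.1) (bword (MZV.weight t.1) t.1) q) : KZ.FormalRep ⧸ KZ.relations) := by
    rw [hm, QuotientAddGroup.mk_sum, Finset.smul_sum]
    refine Finset.sum_congr rfl fun t _ => ?_
    rw [zsmul_mk_zWord, zsmul_mk_zWord, zWord_bword_eq_zIdx t.2.2]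
    simp only [zIdx]
    congr 2
    push_cast
    rw [mul_div_assoc', mul_comm (D : ℚ) _, mul_div_assoc, div_self hD', mul_one]
  have hsQ : (QuotientAddGroup.mk (zWord (MZV.weight sidx) (bword (MZV.weight sidx) sidx) q) :
      KZ.FormalRep ⧸ KZ.relations) = QuotientAddGroup.mk (zWord (MZV.weight sidx) ε q) := by
    rw [hbw]
  have hdiff : (D : ℤ) • ((QuotientAddGroup.mk (zWord (MZV.weight sidx) ε q) :
      KZ.FormalRep ⧸ KZ.relations) - QuotientAddGroup.mk m) = 0 := by
    rw [smul_sub, ← hsQ, hQq, hmQ, sub_self]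
  have hrel' : (D : ℕ) • (zWord (MZV.weight sidx) ε q - m) ∈ KZ.relations := by
    rw [← natCast_zsmul, ← QuotientAddGroup.eq_zero_iff, QuotientAddGroup.mk_zsmul,
      QuotientAddGroup.mk_sub]
    exact hdiff
  have hrel'' : zWord (MZV.weight sidx) ε q - m ∈ KZ.relations :=
    Summit.KontsevichZagierPeriods.FurushoPentagon.integerDivision_proof _ D hD hrel'
  refine ⟨m, ?_, ?_⟩
  · rw [hm]
    refine sum_mem fun t _ => AddSubgroup.subset_closure ?_
    exact zWord_bword_mem_hoffmanGens t.2.1 t.2.2 _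
  · have h1 : KZ.of s - KZ.of (wordRep ε q hε) ∈ KZ.relations :=
      of_sub_of_wordRep_mem_relations hε s hd hi
    rw [zWord_of_adm hε] at hrel''
    have : KZ.of s - m = (KZ.of s - KZ.of (wordRep ε q hε)) + (KZ.of (wordRep ε q hε) - m) := by abel
    rw [this]
    exact add_mem h1 hrel''

/-! ## Composition -/

/-- **The bridge of the line, PROVED**: under `PentagonInKZ` and `ReducedPeriodRing`, the associator
leaf at every admissible index gives every weight slice of the crux. -/
theorem bridge (hP : PentagonInKZ) (hR : ReducedPeriodRing)
    (hA : ∀ s : List ℕ, MZV.IsAdmissible s → LeafAt s) : ∀ N : ℕ, SpanAt N :=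
  fun _ => spanAt_of_formalSpanW fun s hs _ => formalSpanW_of_leafAt hP hR hs (hA s hs)

/-- The leaf in every weight: tree theorem for weights `≤ 17`, the tail stub beyond. -/
theorem leafAt_all
    (hT : ∀ s : List ℕ, MZV.IsAdmissible s → 18 ≤ MZV.weight s → LeafAt s) :
    ∀ s : List ℕ, MZV.IsAdmissible s → LeafAt s := by
  intro s hs
  by_cases h : MZV.weight s ≤ 17
  · exact stub_associatorHoffmanSpanning_of_weight_le_17 s hs h
  · exact hT s hs (by omega)

/-- **The crux from the stub statements** (sorry-free composition): a kernel-checked DECOMPOSITION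
`ReducedPeriodRing → (associator leaf in weights ≥ 18) → PentagonInKZ → HoffmanSpanInKZ`. -/
theorem HoffmanSpanInKZ_of_stubs
    (h₁ : ReducedPeriodRing)
    (h₂ : ∀ s : List ℕ, MZV.IsAdmissible s → 18 ≤ MZV.weight s → LeafAt s)
    (h₃ : PentagonInKZ) :
    HoffmanSpanInKZ :=
  hoffmanSpanInKZ_iff.mpr (bridge h₃ h₁ (leafAt_all h₂))

/-- **The crux** `HoffmanSpanInKZ`, by name, from the three stubs. -/
theorem HoffmanSpanInKZ_of : HoffmanSpanInKZ :=
  HoffmanSpanInKZ_of_stubs stub_reducedPeriodRing stub_assocTail stub_pentagonInKZ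

end Summit.KontsevichZagierPeriods.KontsevichZagierPeriods.Cruxes.HoffmanSpanInKZ.AssocReduced
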